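import Summits.CriticalPhenomena.PercolationContinuityZ3.Theorems.Transplant.PlanarSkeletonFrmColumnsDeg
import HarnessLib

/-!
# Φ2 at the interface level, IX: the COORDINATE SWAP of a frames-only skeleton — column data / degree windows may be taken in EITHER planar direction

builds on p205010 (kernel theorem, internal audit signed; external expert review pending): §2's unconditional corollary runs through the CLOSED
multi-type D″ node `samePDropOfSkeletonSign_holds` (near-one gluing, which builds on p205010); nothing here is a claim about any open node.
Lane `prim-bschramm`, seat `prim-bschramm-p4` gen 14 (PART C3 of `P4-GENERAL.md`, §36).  Helper file
(`--supports stmt-CriticalPhenomena-4575 --as helper`).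

Files I–VII build the column classes in the FIRST skeleton coordinate.  The swapped chart `φ ↦ (φ₁, φ₀)` is again a `PlanarSkeletonFrm` with the
same base vertices and the SAME cylinders (boxes are symmetric), hence the same Φ2; so every criterion of files V/VII (one type; column data; degree
window; unique column neighbours) may be checked in the second coordinate instead (`cylSubcritical_criticalProb_of_colData_swap`,
`…_of_degrees_swap`, `…_of_unique_row`).  Example (P4-GENERAL §36.3): the 3-type twin/shift graph has NO column data in the first coordinate but
unique column neighbours in the second, so its Φ2 follows from this file.  The general multi-type statement (a finite spanning forest of the slab in
which every vertex of the small cylinder is internal, §36.7) stays open.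
[cite: AizenmanGrimmett1991, Thm 1 (essential enhancements)] [cite: KozmaNitzan2024, §4 p. 15 (boxes and their translates)]
-/

noncomputable section

namespace Summit.CriticalPhenomena.PercolationContinuityZ3.Theorems.Transplant

open SimpleGraph Literature.Probability.LatticeModels Literature.Probability.Percolation
open Literature.Barriers.CriticalPhenomena (countable_of_connected_of_locallyFinite)
open scoped Classical

variable {V : Type} {G : SimpleGraph V} [G.LocallyFinite]

/-! ## §1 The swapped skeleton -/

/-- The coordinate swap of `ℤ²`. [folklore] -/
def swapSite (z : Site 2) : Site 2 := fun i => z (Equiv.swap (0 : Fin 2) 1 i)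

omit [G.LocallyFinite] in
/-- `swapSite` unfolded. [folklore] -/
@[simp] theorem swapSite_apply (z : Site 2) (i : Fin 2) : swapSite z i = z (Equiv.swap (0 : Fin 2) 1 i) := rfl

omit [G.LocallyFinite] in
/-- Boxes are symmetric under the coordinate swap. [folklore] -/
theorem swapSite_mem_box_iff (z : Site 2) (ℓ : ℕ) : swapSite z ∈ box 2 ℓ ↔ z ∈ box 2 ℓ := by
  simp only [mem_box, swapSite_apply]
  constructor
  · intro h i
    have := h (Equiv.swap (0 : Fin 2) 1 i)
    rwa [Equiv.swap_apply_self] at this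
  · intro h i
    exact h _

omit [G.LocallyFinite] in
/-- The swap is additive. [folklore] -/
theorem swapSite_sub (z z' : Site 2) : swapSite (z - z') = swapSite z - swapSite z' := by
  ext i; simp

namespace PlanarSkeletonFrm

variable (Φ : PlanarSkeletonFrm G)

/-- **The swapped skeleton** `φ ↦ (φ₁, φ₀)`: still a `PlanarSkeletonFrm` (same types, frames, degree bound; steps re-indexed; cylinders equal as sets). [this work] -/
def swap : PlanarSkeletonFrm G where
  φ := fun w => swapSite (Φ.φ w)
  lip := fun u v huv i => Φ.lip huv _
  types := Φ.types
  frame := by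
    intro v
    obtain ⟨t, ht, α, hαt, hα⟩ := Φ.frame v
    refine ⟨t, ht, α, hαt, fun w => ?_⟩
    ext i
    simp only [swapSite_apply, Pi.add_apply, Pi.sub_apply, hα w]
  Δ := Φ.Δ
  degree_le := Φ.degree_le
  step := by
    intro v i σ
    obtain ⟨v', hadj, hφ⟩ := Φ.step v (Equiv.swap (0 : Fin 2) 1 i) σ
    refine ⟨v', hadj, ?_⟩
    ext j
    simp only [swapSite_apply, hφ, Pi.add_apply]
    congr 1
    by_cases hj : j = i
    · subst hj; rw [Pi.single_eq_same, Pi.single_eq_same]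
    · rw [Pi.single_eq_of_ne hj, Pi.single_eq_of_ne]
      intro h; exact hj ((Equiv.swap (0 : Fin 2) 1).injective h)
  cyl_connected := by
    intro t ht ℓ hℓ
    have hset : {w : V | swapSite (Φ.φ w) - swapSite (Φ.φ t) ∈ box 2 ℓ} = {w : V | Φ.φ w - Φ.φ t ∈ box 2 ℓ} := by
      ext w; simp only [Set.mem_setOf_eq, ← swapSite_sub, swapSite_mem_box_iff]
    rw [hset]
    exact Φ.cyl_connected t ht ℓ hℓ

/-- The swapped skeleton has the same cylinders. [folklore] -/
theorem swap_cyl (t : V) (ℓ : ℕ) : Φ.swap.cyl t ℓ = Φ.cyl t ℓ := by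
  ext w
  simp only [cyl, Set.mem_setOf_eq]
  show swapSite (Φ.φ w) - swapSite (Φ.φ t) ∈ box 2 ℓ ↔ _
  rw [← swapSite_sub, swapSite_mem_box_iff]

/-- **Φ2 is invariant under the coordinate swap.** [folklore] -/
theorem swap_cylSubcritical_iff (p : unitInterval) : Φ.swap.CylSubcritical p ↔ Φ.CylSubcritical p := by
  unfold CylSubcritical
  refine forall₂_congr fun t _ => forall_congr' fun ℓ => ?_
  have key : ∀ (S S' : Set V) (e : S = S') (hm : t ∈ S) (hm' : t ∈ S'),
      theta (G.induce S) ⟨t, hm⟩ p = theta (G.induce S') ⟨t, hm'⟩ p := by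
    intro S S' e hm hm'; subst e; rfl
  constructor
  · intro h; rw [← key _ _ (Φ.swap_cyl t ℓ)]; exact h
  · intro h; rw [key _ _ (Φ.swap_cyl t ℓ)]; exact h

/-- The ROW-neighbours (`φ ↦ φ + e₁`) are the up-neighbours of the swapped skeleton. [folklore] -/
theorem swap_upNbrs (w : V) : Φ.swap.upNbrs w = Φ.nbrsAt (Pi.single 1 1) w := by
  ext w'
  rw [Φ.swap.mem_upNbrs, Φ.mem_nbrsAt]
  refine and_congr Iff.rfl ⟨fun h => ?_, fun h => ?_⟩
  · ext j
    have hj := congrFun h (Equiv.swap (0 : Fin 2) 1 j)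
    simp only [swap, swapSite_apply, Pi.add_apply, Equiv.swap_apply_self] at hj
    rw [hj, Pi.add_apply]
    congr 1
    fin_cases j <;> simp [Equiv.swap_apply_left, Equiv.swap_apply_right]
  · ext j
    simp only [swap, swapSite_apply, Pi.add_apply, h]
    fin_cases j <;> simp [Equiv.swap_apply_left, Equiv.swap_apply_right]

/-- The row-neighbours on the other side (`φ ↦ φ − e₁`) are the down-neighbours of the swapped skeleton. [folklore] -/
theorem swap_downNbrs (w : V) : Φ.swap.downNbrs w = Φ.nbrsAt (Pi.single 1 (-1)) w := by
  ext w'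
  rw [Φ.swap.mem_downNbrs, Φ.mem_nbrsAt]
  refine and_congr Iff.rfl ⟨fun h => ?_, fun h => ?_⟩
  · ext j
    have hj := congrFun h (Equiv.swap (0 : Fin 2) 1 j)
    simp only [swap, swapSite_apply, Pi.add_apply, Equiv.swap_apply_self] at hj
    rw [hj, Pi.add_apply]
    congr 1
    fin_cases j <;> simp [Equiv.swap_apply_left, Equiv.swap_apply_right]
  · ext j
    simp only [swap, swapSite_apply, Pi.add_apply, h]
    fin_cases j <;> simp [Equiv.swap_apply_left, Equiv.swap_apply_right]

/-! ## §2 Φ2 criteria in the second coordinate -/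

/-- **Φ2 at `p_c` from column data IN THE SECOND COORDINATE** (any number of types). [cite: AizenmanGrimmett1991, Thm 1] -/
theorem cylSubcritical_criticalProb_of_colData_swap (hC : ∀ t ∈ Φ.types, ∀ ℓ, Nonempty (Φ.swap.ColData t ℓ)) (t₀ : V) :
    Φ.CylSubcritical (criticalProbIOf G t₀) :=
  (Φ.swap_cylSubcritical_iff _).1 (Φ.swap.cylSubcritical_criticalProb_of_colData hC t₀)

/-- **Φ2 at `p_c` from a degree window in the second coordinate**: `#{φ ↦ φ+e₁ neighbours} ≤ d ≤ #{φ ↦ φ−e₁ neighbours}` everywhere.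
[cite: AizenmanGrimmett1991, Thm 1 (essential enhancements)] -/
theorem cylSubcritical_criticalProb_of_degrees_swap {d : ℕ} (hup : ∀ w, (Φ.nbrsAt (Pi.single 1 1) w).card ≤ d)
    (hdown : ∀ w, d ≤ (Φ.nbrsAt (Pi.single 1 (-1)) w).card) (t₀ : V) : Φ.CylSubcritical (criticalProbIOf G t₀) :=
  (Φ.swap_cylSubcritical_iff _).1 (Φ.swap.cylSubcritical_criticalProb_of_degrees (d := d)
    (fun w => by rw [Φ.swap_upNbrs]; exact hup w) (fun w => by rw [Φ.swap_downNbrs]; exact hdown w) t₀)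

/-- **Φ2 at `p_c` from the mirror window in the second coordinate.** [cite: AizenmanGrimmett1991, Thm 1 (essential enhancements)] -/
theorem cylSubcritical_criticalProb_of_degrees_swap' {d : ℕ} (hdown : ∀ w, (Φ.nbrsAt (Pi.single 1 (-1)) w).card ≤ d)
    (hup : ∀ w, d ≤ (Φ.nbrsAt (Pi.single 1 1) w).card) (t₀ : V) : Φ.CylSubcritical (criticalProbIOf G t₀) :=
  (Φ.swap_cylSubcritical_iff _).1 (Φ.swap.cylSubcritical_criticalProb_of_degrees' (d := d)
    (fun w => by rw [Φ.swap_downNbrs]; exact hdown w) (fun w => by rw [Φ.swap_upNbrs]; exact hup w) t₀)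

/-- **Φ2 at `p_c` from unique ROW neighbours** (exactly one neighbour at `φ + e₁` and one at `φ − e₁`, any number of types) — e.g. the 3-type
twin/shift graph of P4-GENERAL §36.3. [cite: AizenmanGrimmett1991, Thm 1 (essential enhancements)] -/
theorem cylSubcritical_criticalProb_of_unique_row (hup : ∀ w, (Φ.nbrsAt (Pi.single 1 1) w).card = 1)
    (hdown : ∀ w, (Φ.nbrsAt (Pi.single 1 (-1)) w).card = 1) (t₀ : V) : Φ.CylSubcritical (criticalProbIOf G t₀) :=
  Φ.cylSubcritical_criticalProb_of_degrees_swap (d := 1) (fun w => (hup w).le) (fun w => (hdown w).ge) t₀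

end PlanarSkeletonFrm

/-- **THEOREM (unconditional): a `PlanarSkeletonSign` — any number of types — with unique ROW neighbours has `θ_v(p_c) = 0` at every vertex.**
builds on p205010 (kernel theorem, internal audit signed; external expert review pending). [cite: BenjaminiSchramm1996, Conj. 4] -/
theorem PlanarSkeletonSign.criticalContinuity_of_unique_row (Φ : PlanarSkeletonSign G)
    (hup : ∀ w, (Φ.toPlanarSkeletonNeg.toFrm.nbrsAt (Pi.single 1 1) w).card = 1)
    (hdown : ∀ w, (Φ.toPlanarSkeletonNeg.toFrm.nbrsAt (Pi.single 1 (-1)) w).card = 1) (v : V) : theta G v (criticalProbIOf G v) = 0 :=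
  PlanarSkeletonSign.criticalContinuity' G Φ (fun t _ => (Φ.toPlanarSkeletonNeg.cylSubcritical_toFrm_iff _).1
    (Φ.toPlanarSkeletonNeg.toFrm.cylSubcritical_criticalProb_of_unique_row hup hdown t)) v

end Summit.CriticalPhenomena.PercolationContinuityZ3.Theorems.Transplant

end
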